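import Literature.NumberTheory.EllipticCurves.CyclotomicZpExtensionLayerOneSqrtTwoProofs
import Literature.NumberTheory.EllipticCurves.ZpExtensionRestrict
import Literature.NumberTheory.GaloisRepresentations.ImaginaryQuadraticCyclotomicProofs
import Literature.NumberTheory.GaloisRepresentations.InducedGaloisRep
import HarnessLib

set_option autoImplicit false

/-!
# Restriction of the cyclotomic `ℤ₂`-extension of `ℚ` to a number field `L` with `4 ∤ [L : ℚ]`:
# `κ ∘ res : Γ_L → ℤ₂` is onto UNLESS `√2 ∈ L` (i.e. `L ∩ ℚ_∞ = ℚ` unless `L ⊇ ℚ_1 = ℚ(√2)`)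

Topic `Literature/NumberTheory/EllipticCurves` (companion of `ZpExtensionRestrict.lean`, `ZpExtensionRestrictProofs.lean`:
there `κ ∘ res` is onto for `[L : K]` prime to `p`). THEOREM-ONLY file (no definition, no named fact, no `sorry`), written
by the prover seat `bsd-2adic-k4-w1` GEN 2 (cell `bsd-2adic`; supports stmt-BirchSwinnertonDyer-22615 — the `S₃`-sextic
`L = ℚ(W[2])` has degree `6 = 2·3`, and the μ-descent `ℚ(W[2]) → ℚ(P)` of `IwasawaTheory/ClassicalMuVanishesFiniteDescent.lean`
needs `κ ∘ res_{ℚ,L}` onto).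

Washington, *Introduction to Cyclotomic Fields*, §13.1: the restricted tower `L·ℚ_∞/L` has group `≅ ℤ₂` of index
`[L ∩ ℚ_∞ : ℚ]` in `Gal(ℚ_∞/ℚ)`; `ℚ_∞` has the single quadratic subfield `ℚ_1 = ℚ(ζ₈)⁺ = ℚ(√2)` (tree
`IsCyclotomic.exists_sq_eq_two_layer_one`). So when `4 ∤ [L : ℚ]` the intersection `L ∩ ℚ_∞` is `ℚ` or `ℚ(√2)`:

* `ofAdd_two_mul_mem_map_range` — the image `κ(res Γ_L) ≤ ℤ₂` contains `2ℤ₂` (its index divides `[L : ℚ]`, `4 ∤ [L : ℚ]`,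
  and the odd part of the index is a unit of `ℤ₂`).
* `surjective_comp_absGaloisRestrict_of_exists_not_dvd` — if moreover some `κ(res τ)` is a `2`-adic unit, the image is all of `ℤ₂`
  (`y = c·x₀ = (c mod 2)·x₀ + 2(…)`).
* **`surjective_comp_absGaloisRestrict_or_exists_sq_eq_two`** — `κ` a cyclotomic `ℤ₂`-extension of `ℚ`, `L` a number field
  with `4 ∤ [L : ℚ]`: EITHER `κ ∘ res_{ℚ,L}` is surjective (so `κ.restrict L _` is the cyclotomic `ℤ₂`-extension of `L` and
  its layers are the `L·ℚ_n`), OR `L` contains a square root of `2` (then `res(Γ_L) ≤ κ⁻¹(2ℤ₂) = Gal(ℚ̄/ℚ_1)` fixes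
  `√2 ∈ ℚ_1`, which therefore lies in the copy of `L` in `ℚ̄` — infinite Galois correspondence,
  `Rat.exists_eq_of_forall_range_absGaloisRestrict_smul`).
* `surjective_comp_absGaloisRestrict_of_forall_sq_ne_two` — the contrapositive packaging used by consumers.

References: [Washington1997] L. Washington, *Introduction to Cyclotomic Fields*, 2nd ed., §13.1; [NeukirchANT1999] Ch. IV §1
(`[Γ_K : res Γ_L] = [L : K]`).
-/

noncomputable section

open Field Literature.NumberTheory.GaloisRepresentations

universe v

namespace Literature.NumberTheory.EllipticCurves.ZpExtension

/-! ### §1 Arithmetic in `ℤ₂`: odd naturals are units; `c = (c mod 2) + 2e` -/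

/-- An odd natural number is a unit of `ℤ₂`. [folklore] -/
private theorem isUnit_natCast_padicInt_two_of_odd {m : ℕ} (hm : Odd m) : IsUnit ((m : ℕ) : ℤ_[2]) := by
  rw [PadicInt.isUnit_iff]
  have hle : ‖((m : ℕ) : ℤ_[2])‖ ≤ 1 := PadicInt.norm_le_one _
  have hlt : ¬ ‖((m : ℕ) : ℤ_[2])‖ < 1 := by
    intro h
    have h' : ‖((m : ℤ) : ℤ_[2])‖ < 1 := by exact_mod_cast h
    rw [PadicInt.norm_int_lt_one_iff_dvd] at h'
    have h2 : (2 : ℤ) ∣ (m : ℤ) := by exact_mod_cast h'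
    have h3 : 2 ∣ m := by exact_mod_cast h2
    exact (Nat.not_even_iff_odd.mpr hm) (even_iff_two_dvd.mpr h3)
  exact le_antisymm hle (not_lt.mp hlt)

/-- A `2`-adic integer not divisible by `2` is a unit. [folklore] -/
private theorem isUnit_of_not_two_dvd {x : ℤ_[2]} (hx : ¬ (2 : ℤ_[2]) ∣ x) : IsUnit x := by
  rw [PadicInt.isUnit_iff]
  have hle : ‖x‖ ≤ 1 := PadicInt.norm_le_one _
  have hlt : ¬ ‖x‖ < 1 := fun h => hx (by
    have := (PadicInt.norm_lt_one_iff_dvd x).mp h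
    exact_mod_cast this)
  exact le_antisymm hle (not_lt.mp hlt)

/-- `c = v + 2·e` with `v ∈ {0, 1}` (reduction mod `2`, `PadicInt.toZMod`, kernel `= (2)`). [folklore] -/
private theorem exists_eq_add_two_mul (c : ℤ_[2]) : ∃ (v : ℕ) (e : ℤ_[2]), v < 2 ∧ c = (v : ℤ_[2]) + 2 * e := by
  set v : ℕ := (PadicInt.toZMod c : ZMod 2).val with hv
  have hv2 : v < 2 := ZMod.val_lt _
  have hker : c - (v : ℤ_[2]) ∈ RingHom.ker (PadicInt.toZMod : ℤ_[2] →+* ZMod 2) := by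
    rw [RingHom.mem_ker, map_sub, map_natCast, hv, ZMod.natCast_zmod_val, sub_self]
  rw [PadicInt.ker_toZMod, PadicInt.maximalIdeal_eq_span_p, Ideal.mem_span_singleton] at hker
  obtain ⟨e, he⟩ := hker
  have he' : c - (v : ℤ_[2]) = 2 * e := by
    have h := he; push_cast at h; exact h
  exact ⟨v, e, hv2, by linear_combination he'⟩

/-! ### §2 The image `κ(res Γ_L) ≤ ℤ₂` when `4 ∤ [L : ℚ]` -/

variable (κ : ZpExtension ℚ 2) (L : Type v) [Field L] [NumberField L]

/-- **`2ℤ₂ ⊆ κ(res Γ_L)` when `4 ∤ [L : ℚ]`**: the image `M` of `res(Γ_L)` (index `[L : ℚ]` in `Γ_ℚ`,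
`nat_card_quotient_range_absGaloisRestrict`) under the surjection `κ` has index dividing `[L : ℚ] = 2^a·m` with `a ≤ 1`,
`m` odd; `y^{[M]} ∈ M` for every `y` (`Subgroup.pow_index_mem`) and `m ∈ ℤ₂ˣ`, so `2ℤ₂ ⊆ [M]·ℤ₂ ⊆ M`.
[cite: Washington1997, §13.1] [cite: NeukirchANT1999, Ch. IV §1] -/
theorem ofAdd_two_mul_mem_map_range (h4 : ¬ 4 ∣ Module.finrank ℚ L) (z : ℤ_[2]) :
    Multiplicative.ofAdd (2 * z) ∈
      ((absGaloisRestrict ℚ L).range).map κ.toContinuousMonoidHom.toMonoidHom := by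
  set H : Subgroup (absoluteGaloisGroup ℚ) := (absGaloisRestrict ℚ L).range with hH
  set f : absoluteGaloisGroup ℚ →* Multiplicative ℤ_[2] := κ.toContinuousMonoidHom.toMonoidHom with hf
  set M := H.map f with hM
  have hHidx : H.index = Module.finrank ℚ L := nat_card_quotient_range_absGaloisRestrict ℚ L
  have hMdvd : M.index ∣ Module.finrank ℚ L := hHidx ▸ Subgroup.index_map_dvd H κ.surjective
  have hd0 : Module.finrank ℚ L ≠ 0 := Module.finrank_pos.ne'
  have hi0 : M.index ≠ 0 := fun h0 => hd0 (zero_dvd_iff.mp (h0 ▸ hMdvd))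
  obtain ⟨a, m, hm, him⟩ := Nat.exists_eq_two_pow_mul_odd hi0
  -- `a ≤ 1` since `4 ∤ [L : ℚ]`
  have ha : a ≤ 1 := by
    by_contra ha
    have h4i : 4 ∣ M.index := by
      rw [him]
      have h22 : (2 : ℕ) ^ 2 ∣ 2 ^ a := pow_dvd_pow 2 (by omega)
      exact Dvd.dvd.mul_right (by norm_num at h22 ⊢; exact h22) m
    exact h4 (h4i.trans hMdvd)
  obtain ⟨u, hu⟩ := isUnit_natCast_padicInt_two_of_odd hm
  -- `2 = [M] · w₀` in `ℤ₂`
  obtain ⟨w₀, hw₀⟩ : ∃ w₀ : ℤ_[2], (M.index : ℤ_[2]) * w₀ = 2 := by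
    interval_cases a
    · refine ⟨(↑u⁻¹ : ℤ_[2]) * 2, ?_⟩
      rw [him]; push_cast
      rw [one_mul, ← hu, ← mul_assoc, Units.mul_inv, one_mul]
    · refine ⟨(↑u⁻¹ : ℤ_[2]), ?_⟩
      rw [him]; push_cast
      rw [mul_assoc, ← hu, Units.mul_inv, mul_one]
  have key : Multiplicative.ofAdd (2 * z) = (Multiplicative.ofAdd (w₀ * z)) ^ M.index := by
    rw [← ofAdd_nsmul, nsmul_eq_mul, ← mul_assoc, hw₀]
  rw [key]
  exact Subgroup.pow_index_mem M _

/-- **If some `κ(res τ)` is a `2`-adic unit, then `κ ∘ res_{ℚ,L}` is onto** (`4 ∤ [L : ℚ]`): every `y ∈ ℤ₂` is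
`c·x₀ = v·x₀ + 2·(e x₀)` with `v ∈ {0,1}`, and both summands lie in the image (`ofAdd_two_mul_mem_map_range`).
[cite: Washington1997, §13.1] -/
theorem surjective_comp_absGaloisRestrict_of_exists_not_dvd (h4 : ¬ 4 ∣ Module.finrank ℚ L)
    (hex : ∃ σ : absoluteGaloisGroup L, ¬ (2 : ℤ_[2]) ∣ (κ (absGaloisRestrict ℚ L σ)).toAdd) :
    Function.Surjective (κ.toContinuousMonoidHom.comp (absGaloisRestrict ℚ L)) := by
  obtain ⟨σ₀, hσ₀⟩ := hex
  set x₀ : ℤ_[2] := (κ (absGaloisRestrict ℚ L σ₀)).toAdd with hx₀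
  obtain ⟨u₀, hu₀⟩ := isUnit_of_not_two_dvd hσ₀
  set M := ((absGaloisRestrict ℚ L).range).map κ.toContinuousMonoidHom.toMonoidHom with hM
  have hx₀M : Multiplicative.ofAdd x₀ ∈ M :=
    ⟨absGaloisRestrict ℚ L σ₀, ⟨σ₀, rfl⟩, by rw [hx₀, ofAdd_toAdd]; rfl⟩
  -- every `y` lies in `M`
  have hall : ∀ y : ℤ_[2], Multiplicative.ofAdd y ∈ M := by
    intro y
    set c : ℤ_[2] := y * (↑u₀⁻¹ : ℤ_[2]) with hc
    have hyc : y = c * x₀ := by rw [hc, mul_assoc, ← hu₀, Units.inv_mul, mul_one]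
    obtain ⟨v, e, -, hce⟩ := exists_eq_add_two_mul c
    have hy : Multiplicative.ofAdd y =
        (Multiplicative.ofAdd x₀) ^ v * Multiplicative.ofAdd (2 * (e * x₀)) := by
      rw [← ofAdd_nsmul, ← ofAdd_add, nsmul_eq_mul, hyc, hce]
      congr 1
      ring
    rw [hy]
    exact M.mul_mem (M.pow_mem hx₀M v) (ofAdd_two_mul_mem_map_range κ L h4 (e * x₀))
  intro y
  obtain ⟨τ, ⟨σ, rfl⟩, hτ⟩ := Subgroup.mem_map.mp (hall y.toAdd)
  refine ⟨σ, ?_⟩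
  rw [ofAdd_toAdd] at hτ
  exact hτ

/-! ### §3 The dichotomy: onto, or `√2 ∈ L` -/

/-- **`κ ∘ res_{ℚ,L}` is onto, or `√2 ∈ L`** (`κ` a cyclotomic `ℤ₂`-extension of `ℚ`, `L` a number field with
`4 ∤ [L : ℚ]`). If it is not onto, every `κ(res τ)` is divisible by `2` (previous lemma), i.e. `res(Γ_L) ≤ κ⁻¹(2ℤ₂) =
Gal(ℚ̄/ℚ_1)`; the first layer `ℚ_1` contains `θ` with `θ² = 2` (`IsCyclotomic.exists_sq_eq_two_layer_one`), which is then
fixed by `res(Γ_L) = Gal(ℚ̄/e(L))`, hence `θ = e(x)` for some `x ∈ L` (infinite Galois correspondence,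
`Rat.exists_eq_of_forall_range_absGaloisRestrict_smul`) and `x² = 2`. [cite: Washington1997, §13.1] -/
theorem surjective_comp_absGaloisRestrict_or_exists_sq_eq_two (hκ : κ.IsCyclotomic)
    (h4 : ¬ 4 ∣ Module.finrank ℚ L) :
    Function.Surjective (κ.toContinuousMonoidHom.comp (absGaloisRestrict ℚ L)) ∨ ∃ x : L, x ^ 2 = 2 := by
  by_cases hex : ∃ σ : absoluteGaloisGroup L, ¬ (2 : ℤ_[2]) ∣ (κ (absGaloisRestrict ℚ L σ)).toAdd
  · exact Or.inl (surjective_comp_absGaloisRestrict_of_exists_not_dvd κ L h4 hex)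
  right
  simp only [not_exists, not_not] at hex
  -- `res(Γ_L) ≤ κ⁻¹(2ℤ₂)`
  have hlayer : ∀ σ : absoluteGaloisGroup L, absGaloisRestrict ℚ L σ ∈ κ.layerSubgroup 1 := fun σ => by
    rw [mem_layerSubgroup, pow_one]
    exact hex σ
  obtain ⟨θ, hθ⟩ := IsCyclotomic.exists_sq_eq_two_layer_one hκ
  have hθmem := (IntermediateField.mem_fixedField_iff _ (θ : AlgebraicClosure ℚ)).mp θ.2
  -- `θ` is fixed by `res(Γ_L)`
  have hfix : ∀ τ ∈ ((absGaloisRestrict ℚ L).range : Subgroup (absoluteGaloisGroup ℚ)),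
      τ • (θ : AlgebraicClosure ℚ) = θ := by
    rintro _ ⟨σ, rfl⟩
    exact hθmem _ ⟨absGaloisRestrict ℚ L σ, hlayer σ, rfl⟩
  obtain ⟨e, x, hex⟩ := Rat.exists_eq_of_forall_range_absGaloisRestrict_smul L hfix
  refine ⟨x, e.toRingHom.injective ?_⟩
  have h2 : ((θ : AlgebraicClosure ℚ)) ^ 2 = 2 := by
    have := congrArg (fun t : κ.layer 1 => (t : AlgebraicClosure ℚ)) hθ
    push_cast at this
    exact this
  change e (x ^ 2) = e 2
  rw [map_pow, hex, h2, map_ofNat]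

/-- **`κ ∘ res_{ℚ,L}` is onto as soon as `√2 ∉ L`** (`4 ∤ [L : ℚ]`): the contrapositive packaging, the surjectivity witness
for `κ.restrict L _` (the cyclotomic `ℤ₂`-extension `L·ℚ_∞/L` with layers `L·ℚ_n`). [cite: Washington1997, §13.1] -/
theorem surjective_comp_absGaloisRestrict_of_forall_sq_ne_two (hκ : κ.IsCyclotomic) (h4 : ¬ 4 ∣ Module.finrank ℚ L)
    (h2 : ∀ x : L, x ^ 2 ≠ 2) : Function.Surjective (κ.toContinuousMonoidHom.comp (absGaloisRestrict ℚ L)) := by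
  rcases surjective_comp_absGaloisRestrict_or_exists_sq_eq_two κ L hκ h4 with h | ⟨x, hx⟩
  · exact h
  · exact absurd hx (h2 x)

end Literature.NumberTheory.EllipticCurves.ZpExtension

end
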